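import Literature.NumberTheory.NumberFields.PrincipalIdelesFiniteClosure
import Literature.NumberTheory.NumberFields.ArtinMapDecompositionInertia
import Literature.NumberTheory.NumberFields.IdeleOpenSubgroupFiniteIndex
import Literature.NumberTheory.NumberFields.FiniteIdelePrescribedIdeal
import Literature.NumberTheory.NumberFields.RayClassFieldIdelic
import Literature.NumberTheory.GaloisRepresentations.GlobalArtinMapAbstractExtensionProofs
import HarnessLib

/-!
# The four-term sequence of class field theory at a finite level — preliminaries: `p`-saturation of a
# subgroup, `p`-power behaviour of principal units at `w ∣ p`, the idèle `ι_S(y) = ∏_{w∈S} ⟨y_w⟩_w`, the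
# modulus `𝔪 = ∏_{w∈S} 𝔭_w^k` and the open subgroup `Kˣ·(K_∞ˣ × I^𝔪_f)`

Cell `bsd-print-cf2` (HOME `run/shared/lean/pub/bsd-print-cf2/`), seat `bsd-line-cf2c-w6` g3, brick §4(d)
«four-term sequence `0 → Ē_∞ → U_v → 𝒳^{(v)} → A_∞ → 0` (CFT over `𝔎_∞L′`)» of LEAD memo
`Cruxes/SplitBadTwoRankOneOfFacts/RULING-B23-g13.md` §4, crux of record stmt-BirchSwinnertonDyer-24033
`PrintCf2RubinValueTwo.TwoVariableMainConjAtSplitTwoQuad` (S3a-quad). Generations g0/g2 of this seat landed the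
ALGEBRA «four-term ⟹ characteristic-ideal identity» (sockets p682210, p689803, p693447), which take the sequence
itself as binders. Generation g3 supplies the ARITHMETIC of the sequence at one finite level, for an arbitrary
number field `K : Type`, in the tree's proved idelic class field theory (`ideleArtinMap`, `Automorphic.normGroup`,
`localUnits`, `IdeleAction.congruenceUnits`). This first file holds the plumbing shared by the kernel theorem
(`…FourTermCFTKernel`: `U_S ∩ ker = Ē_S`), the «global units die» theorem and the inertia/image theorem:

* §1 group theory: the `p`-saturation `N' = {a : ∃ m, p ∤ m, a^m ∈ N}` of a subgroup (as an existence —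
  no definition), Bezout `a^m, a^n ∈ H, (m,n) = 1 ⟹ a ∈ H`, and `[G : N'] = p^n` when `[G : N] < ∞`;
* §2 local: at `w ∣ p`, for a principal unit `y` (`|y − 1|_w < 1`), `|y^p − 1|_w ≤ |ϖ_w|·|y − 1|_w`, hence
  `|y^{p^r} − 1|_w ≤ |ϖ_w|^r` (Washington §13.1, proof of Thm. 13.4: `U_1^{p^r} ⊆ U_{r+1}`);
* §3 idèles: `(ι_S(y))_f = ∏_{w∈S} single w y_w`, its components (`y_v` on `S`, `1` off `S`), unit idèle;
* §4 the modulus `𝔪_S^k = ∏_{w∈S} 𝔭_w^k` (`ord_v = k` on `S`, `0` off `S`) and the open subgroup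
  `N_𝔪 = {a : a_f ∈ Kˣ·I^𝔪_f} ⊇ Kˣ` of `𝕀_K` (as an existence);
* §5 membership of local idèles / of `ι_S(z)` in the congruence subgroup `I^𝔟_f`.

No `sorry`, no definition, no named fact; Theses-free. No summit statement is proved; BSD is not advanced here.

## References
* [Washington1997] L. Washington, *Introduction to Cyclotomic Fields*, GTM 83, §13.1 Thm. 13.4, Cor. 13.6.
* [deShalit1987] E. de Shalit, *Iwasawa theory of elliptic curves with complex multiplication*, Ch. III §1.1–1.3.
* [NeukirchANT1999] J. Neukirch, *Algebraic Number Theory*, Ch. VI §1 (1.7)–(1.8) (congruence subgroups).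
-/

noncomputable section

set_option linter.dupNamespace false -- D-0017: single-problem summit, `…BirchSwinnertonDyer.BirchSwinnertonDyer…` repeats a namespace by design
set_option autoImplicit false

open NumberField IsDedekindDomain IsDedekindDomain.HeightOneSpectrum WithZero
open scoped nonZeroDivisors Topology
open Literature.NumberTheory Literature.NumberTheory.NumberFields Literature.NumberTheory.GaloisRepresentations

namespace Summit.BirchSwinnertonDyer.BirchSwinnertonDyer.Theorems.PrintCf2.FourTermCFT

/-! ### §1. Group-theoretic lemmas: `p`-saturation of a subgroup, Bezout, `p`-power index -/

/-- The `p`-saturation `N' = {a : ∃ m, (m, p) = 1, a ^ m ∈ N}` of a subgroup of a commutative group exists as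
a subgroup (stated as an existence, so that no definition is introduced). [folklore] -/
theorem exists_subgroup_mem_iff_exists_pow_mem {G : Type*} [CommGroup G] (N : Subgroup G) (p : ℕ) :
    ∃ N' : Subgroup G, ∀ a, a ∈ N' ↔ ∃ m, Nat.Coprime m p ∧ a ^ m ∈ N := by
  refine ⟨{ carrier := {a | ∃ m, Nat.Coprime m p ∧ a ^ m ∈ N}
            mul_mem' := ?_
            one_mem' := ⟨1, Nat.coprime_one_left p, by rw [one_pow]; exact N.one_mem⟩
            inv_mem' := ?_ }, fun a => Iff.rfl⟩
  · rintro a b ⟨m, hm, ha⟩ ⟨n, hn, hb⟩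
    refine ⟨m * n, Nat.Coprime.mul_left hm hn, ?_⟩
    rw [mul_pow, pow_mul, mul_comm m n, pow_mul]
    exact N.mul_mem (N.pow_mem ha n) (N.pow_mem hb m)
  · rintro a ⟨m, hm, ha⟩
    exact ⟨m, hm, by rw [inv_pow]; exact N.inv_mem ha⟩

/-- Bezout in a group: if `a ^ m ∈ H` and `a ^ n ∈ H` with `(m, n) = 1` then `a ∈ H`. [folklore] -/
theorem mem_of_pow_mem_of_coprime {G : Type*} [Group G] (H : Subgroup G) {a : G} {m n : ℕ}
    (hmn : Nat.Coprime m n) (hm : a ^ m ∈ H) (hn : a ^ n ∈ H) : a ∈ H := by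
  obtain ⟨u, v, huv⟩ := Nat.isCoprime_iff_coprime.mpr hmn
  have key : a = (a ^ m) ^ u * (a ^ n) ^ v := by
    conv_lhs => rw [← zpow_one a, ← huv]
    rw [zpow_add, mul_comm u, zpow_mul, mul_comm v, zpow_mul, zpow_natCast, zpow_natCast]
  rw [key]
  exact H.mul_mem (H.zpow_mem hm u) (H.zpow_mem hn v)

/-- If `N` has finite index and `N'` is its `p`-saturation (`p` prime), then `[G : N']` is a power of `p`:
every element of `G ⧸ N'` has `p`-power order (`a ^ [G:N] ∈ N`, `[G:N] = p^r m` with `p ∤ m`).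
[folklore] -/
theorem exists_index_eq_prime_pow {G : Type*} [CommGroup G] {p : ℕ} [hp : Fact p.Prime]
    {N N' : Subgroup G} [N.FiniteIndex] (hN' : ∀ a, a ∈ N' ↔ ∃ m, Nat.Coprime m p ∧ a ^ m ∈ N) :
    ∃ n, N'.index = p ^ n := by
  have hle : N ≤ N' := fun a ha => (hN' a).2 ⟨1, Nat.coprime_one_left p, by rwa [pow_one]⟩
  haveI : N'.FiniteIndex := Subgroup.finiteIndex_of_le hle
  have hpg : IsPGroup p (G ⧸ N') := by
    intro g
    induction g using QuotientGroup.induction_on with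
    | H a =>
      obtain ⟨r, m, hm, hrm⟩ :=
        Nat.exists_eq_pow_mul_and_not_dvd (Subgroup.FiniteIndex.index_ne_zero (H := N)) p hp.out.one_lt.ne'
      refine ⟨r, ?_⟩
      rw [← QuotientGroup.mk_pow, QuotientGroup.eq_one_iff, hN']
      refine ⟨m, (Nat.Prime.coprime_iff_not_dvd hp.out).2 hm |>.symm, ?_⟩
      rw [← pow_mul, ← hrm]
      exact N.pow_index_mem a
  obtain ⟨n, hn⟩ := IsPGroup.iff_card.1 hpg
  exact ⟨n, by rw [Subgroup.index_eq_card, hn]⟩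

/-! ### §2. Principal units at a place above `p`: `y^{p^r} → 1` -/

section Local

variable {K : Type} [Field K] [NumberField K]

/-- In `ℤᵐ⁰`: `x < 1 ↔ x ≤ exp (-1)` (discreteness of the value group). [folklore] -/
theorem lt_one_iff_le_exp_neg_one (x : ℤᵐ⁰) : x < 1 ↔ x ≤ exp (-1) := by
  rw [← WithZero.lt_mul_exp_iff_le exp_ne_zero, ← exp_add]
  norm_num

/-- At a place `w ∣ p`, `|p|_w ≤ |ϖ_w|`: the image of `p` in `K_w` has valuation `< 1`. [folklore] -/
theorem valued_natCast_lt_one {p : ℕ} (w : HeightOneSpectrum (𝓞 K)) (hw : ((p : ℕ) : 𝓞 K) ∈ w.asIdeal) :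
    Valued.v ((p : ℕ) : w.adicCompletion K) < 1 := by
  rw [← map_natCast (algebraMap K (w.adicCompletion K)), ← map_natCast (algebraMap (𝓞 K) K)]
  rw [show algebraMap K (w.adicCompletion K) (algebraMap (𝓞 K) K (p : 𝓞 K)) =
      ((algebraMap (𝓞 K) K (p : 𝓞 K) : K) : w.adicCompletion K) from rfl,
    valuedAdicCompletion_eq_valuation', valuation_of_algebraMap]
  exact (intValuation_lt_one_iff_mem w _).2 hw

/-- For `y ∈ K_w` with `|y − 1|_w < 1`: `|y^i − 1|_w ≤ |y − 1|_w` for every `i` (`y^i − 1 = (∑_{j<i} y^j)(y − 1)`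
with `|∑ y^j| ≤ 1`). [folklore] -/
theorem valued_pow_sub_one_le (w : HeightOneSpectrum (𝓞 K)) {y : w.adicCompletion K}
    (hy : Valued.v (y - 1) < 1) (i : ℕ) : Valued.v (y ^ i - 1) ≤ Valued.v (y - 1) := by
  have hy1 : Valued.v y = 1 := by
    have := Valuation.map_one_add_of_lt Valued.v hy
    rwa [add_sub_cancel] at this
  rw [← geom_sum_mul, Valuation.map_mul]
  refine mul_le_of_le_one_left' (Valuation.map_sum_le _ fun j _ => ?_)
  rw [Valuation.map_pow, hy1, one_pow]

/-- **One `p`-th power gains a factor `|ϖ_w|`**: at `w ∣ p`, for a principal unit `y` (`|y − 1|_w < 1`),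
`|y^p − 1|_w ≤ |ϖ_w| · |y − 1|_w` (`y^p − 1 = (∑_{i<p} y^i)(y − 1)` and `∑_{i<p} y^i ≡ p ≡ 0 (mod 𝔭_w)`).
[cite: Washington1997, §13.1 (proof of Thm. 13.4)] -/
theorem valued_pow_prime_sub_one_le {p : ℕ} (w : HeightOneSpectrum (𝓞 K)) (hw : ((p : ℕ) : 𝓞 K) ∈ w.asIdeal)
    {y : w.adicCompletion K} (hy : Valued.v (y - 1) < 1) :
    Valued.v (y ^ p - 1) ≤ exp (-1) * Valued.v (y - 1) := by
  rw [← geom_sum_mul, Valuation.map_mul]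
  refine mul_le_mul' ?_ le_rfl
  -- `∑_{i<p} y^i = ∑_{i<p} (y^i - 1) + p`
  have hsum : (∑ i ∈ Finset.range p, y ^ i) = (∑ i ∈ Finset.range p, (y ^ i - 1)) + (p : ℕ) := by
    rw [Finset.sum_sub_distrib, Finset.sum_const, Finset.card_range, nsmul_eq_mul, mul_one, sub_add_cancel]
  rw [hsum]
  refine (Valuation.map_add _ _ _).trans (max_le ?_ ?_)
  · refine Valuation.map_sum_le _ fun i _ => (valued_pow_sub_one_le w hy i).trans ?_
    exact (lt_one_iff_le_exp_neg_one _).1 hy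
  · exact (lt_one_iff_le_exp_neg_one _).1 (valued_natCast_lt_one w hw)

/-- **`y^{p^r} → 1`**: at `w ∣ p`, for a principal unit `y`, `|y^{p^r} − 1|_w ≤ |ϖ_w|^r · |y − 1|_w ≤ |ϖ_w|^r`.
[cite: Washington1997, §13.1 (proof of Thm. 13.4)] -/
theorem valued_pow_prime_pow_sub_one_le {p : ℕ} (w : HeightOneSpectrum (𝓞 K)) (hw : ((p : ℕ) : 𝓞 K) ∈ w.asIdeal)
    {y : w.adicCompletion K} (hy : Valued.v (y - 1) < 1) (r : ℕ) :
    Valued.v (y ^ p ^ r - 1) ≤ exp (-(r : ℤ)) := by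
  suffices h : Valued.v (y ^ p ^ r - 1) ≤ exp (-(r : ℤ)) * Valued.v (y - 1) by
    refine h.trans (mul_le_of_le_one_right' ?_)
    exact le_of_lt hy
  induction r with
  | zero => simp
  | succ r ih =>
    have hlt : Valued.v (y ^ p ^ r - 1) < 1 :=
      lt_of_le_of_lt ih (by
        calc exp (-(r : ℤ)) * Valued.v (y - 1) ≤ 1 * Valued.v (y - 1) :=
              mul_le_mul' (by rw [← exp_zero, exp_le_exp]; omega) le_rfl
          _ < 1 := by rw [one_mul]; exact hy)
    rw [pow_succ, pow_mul]
    refine (valued_pow_prime_sub_one_le w hw hlt).trans ?_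
    calc exp (-1) * Valued.v (y ^ p ^ r - 1) ≤ exp (-1) * (exp (-(r : ℤ)) * Valued.v (y - 1)) :=
          mul_le_mul' le_rfl ih
      _ = exp (-((r + 1 : ℕ) : ℤ)) * Valued.v (y - 1) := by
          rw [← mul_assoc, ← exp_add]; congr 2; push_cast; ring

end Local

/-! ### §3. Idèle bookkeeping: `ι_S(y) = ∏_{w∈S} ⟨y_w⟩_w`, its finite part and components -/

section Idele

variable {K : Type} [Field K] [NumberField K]

/-- The finite part of `ι_S(y) = ∏_{w∈S} ⟨y_w⟩_w` is `∏_{w∈S} single w y_w` (one factor: the tree's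
`NumberFields.finitePart_localUnits`). [folklore] -/
theorem finitePart_prod_localUnits (S : Finset (HeightOneSpectrum (𝓞 K)))
    (y : (w : HeightOneSpectrum (𝓞 K)) → (w.adicCompletion K)ˣ) :
    IdeleAction.finitePart K (∏ w ∈ S, localUnits w (y w)) = ∏ w ∈ S, IdeleAction.single w (y w) := by
  rw [map_prod]; rfl

/-- The `v`-component of `∏_{w∈S} single w y_w` at `v ∈ S` is `y_v`. [folklore] -/
theorem coe_prod_single_apply_of_mem {S : Finset (HeightOneSpectrum (𝓞 K))}
    (y : (w : HeightOneSpectrum (𝓞 K)) → (w.adicCompletion K)ˣ) {v : HeightOneSpectrum (𝓞 K)} (hv : v ∈ S) :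
    ((∏ w ∈ S, IdeleAction.single w (y w) : (FiniteAdeleRing (𝓞 K) K)ˣ) : FiniteAdeleRing (𝓞 K) K) v = y v := by
  rw [IdeleAction.coe_prod_apply, Finset.prod_eq_single_of_mem v hv fun w _ hwv =>
    IdeleAction.coe_single_apply_of_ne w (y w) (Ne.symm hwv)]
  exact IdeleAction.coe_single_apply_self v (y v)

/-- The `v`-component of `∏_{w∈S} single w y_w` at `v ∉ S` is `1`. [folklore] -/
theorem coe_prod_single_apply_of_not_mem {S : Finset (HeightOneSpectrum (𝓞 K))}
    (y : (w : HeightOneSpectrum (𝓞 K)) → (w.adicCompletion K)ˣ) {v : HeightOneSpectrum (𝓞 K)} (hv : v ∉ S) :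
    ((∏ w ∈ S, IdeleAction.single w (y w) : (FiniteAdeleRing (𝓞 K) K)ˣ) : FiniteAdeleRing (𝓞 K) K) v = 1 := by
  rw [IdeleAction.coe_prod_apply]
  refine Finset.prod_eq_one fun w hw => IdeleAction.coe_single_apply_of_ne w (y w) ?_
  rintro rfl; exact hv hw

/-- `∏_{w∈S} single w y_w` is a unit idèle when every `y_w`, `w ∈ S`, is a local unit. [folklore] -/
theorem prod_single_mem_ker_toIdealUnits {S : Finset (HeightOneSpectrum (𝓞 K))}
    (y : (w : HeightOneSpectrum (𝓞 K)) → (w.adicCompletion K)ˣ)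
    (hy : ∀ w ∈ S, Valued.v ((y w : w.adicCompletion K)) = 1) :
    (∏ w ∈ S, IdeleAction.single w (y w)) ∈ (IdeleIdeal.toIdealUnits (𝓞 K) K).ker := by
  rw [IdeleIdeal.mem_ker_toIdealUnits_iff_valued]
  intro v
  by_cases hv : v ∈ S
  · rw [coe_prod_single_apply_of_mem y hv]; exact hy v hv
  · rw [coe_prod_single_apply_of_not_mem y hv, Valuation.map_one]

end Idele

/-! ### §4. The modulus `𝔪 = ∏_{w∈S} 𝔭_w^k` and the open subgroup `N = Kˣ·(K_∞ˣ × I^𝔪_f)` -/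

section Modulus

variable {K : Type} [Field K] [NumberField K]

omit [NumberField K] in
/-- `∏_{w∈S} 𝔭_w^k ≠ 0`. [folklore] -/
theorem prod_pow_ne_bot (S : Finset (HeightOneSpectrum (𝓞 K))) (k : ℕ) :
    (∏ w ∈ S, w.asIdeal ^ k : Ideal (𝓞 K)) ≠ ⊥ := by
  rw [← Ideal.zero_eq_bot, Finset.prod_ne_zero_iff]
  exact fun w _ => pow_ne_zero _ w.ne_bot

/-- `(∏_{w∈S} 𝔭_w^k : Ideal) = ∏_{w∈S} 𝔭_w^k` as fractional ideals. [folklore] -/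
theorem coeIdeal_prod_pow (S : Finset (HeightOneSpectrum (𝓞 K))) (k : ℕ) :
    ((∏ w ∈ S, w.asIdeal ^ k : Ideal (𝓞 K)) : FractionalIdeal (𝓞 K)⁰ K) =
      ∏ w ∈ S, (w.asIdeal : FractionalIdeal (𝓞 K)⁰ K) ^ k := by
  change FractionalIdeal.coeIdealHom (𝓞 K)⁰ K _ = _
  rw [map_prod]
  simp only [map_pow, FractionalIdeal.coeIdealHom_apply]

/-- `ord_v (∏_{w∈S} 𝔭_w^k) = k` for `v ∈ S`. [folklore] -/
theorem count_prod_pow_of_mem {S : Finset (HeightOneSpectrum (𝓞 K))} (k : ℕ) {v : HeightOneSpectrum (𝓞 K)}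
    (hv : v ∈ S) :
    FractionalIdeal.count K v ((∏ w ∈ S, w.asIdeal ^ k : Ideal (𝓞 K)) : FractionalIdeal (𝓞 K)⁰ K) = k := by
  rw [coeIdeal_prod_pow]
  rw [FractionalIdeal.count_prod K v _ _ fun w _ => pow_ne_zero _ (FractionalIdeal.coeIdeal_ne_zero.2 w.ne_bot),
    Finset.sum_eq_single_of_mem v hv fun w _ hwv => by
      rw [FractionalIdeal.count_pow, FractionalIdeal.count_maximal_coprime K v hwv, mul_zero]]
  rw [FractionalIdeal.count_pow, FractionalIdeal.count_self, mul_one]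

/-- `ord_v (∏_{w∈S} 𝔭_w^k) = 0` for `v ∉ S`. [folklore] -/
theorem count_prod_pow_of_not_mem {S : Finset (HeightOneSpectrum (𝓞 K))} (k : ℕ) {v : HeightOneSpectrum (𝓞 K)}
    (hv : v ∉ S) :
    FractionalIdeal.count K v ((∏ w ∈ S, w.asIdeal ^ k : Ideal (𝓞 K)) : FractionalIdeal (𝓞 K)⁰ K) = 0 := by
  rw [coeIdeal_prod_pow]
  rw [FractionalIdeal.count_prod K v _ _ fun w _ => pow_ne_zero _ (FractionalIdeal.coeIdeal_ne_zero.2 w.ne_bot)]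
  refine Finset.sum_eq_zero fun w hw => ?_
  rw [FractionalIdeal.count_pow, FractionalIdeal.count_maximal_coprime K v (by rintro rfl; exact hv hw), mul_zero]

/-- **The open subgroup `N_𝔪 = Kˣ · (K_∞ˣ × I^𝔪_f)` of `𝕀_K`** (the idèles whose finite part lies in
`Kˣ · I^𝔪_f`), as an existence with its three properties: membership, openness, `Kˣ ≤ N_𝔪`. [folklore] -/
theorem exists_subgroup_finitePart_mem_sup (𝔪 : Ideal (𝓞 K)) :
    ∃ N : Subgroup (ideleGroup K),
      (∀ a, a ∈ N ↔ IdeleAction.finitePart K a ∈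
        (FiniteAdeleRing.unitEmbedding (𝓞 K) K).range ⊔ IdeleAction.congruenceUnits (K := K) 𝔪) ∧
      IsOpen (N : Set (ideleGroup K)) ∧ principalIdeles K ≤ N := by
  refine ⟨((FiniteAdeleRing.unitEmbedding (𝓞 K) K).range ⊔ IdeleAction.congruenceUnits (K := K) 𝔪).comap
      (IdeleAction.finitePart K), fun a => Iff.rfl, ?_, ?_⟩
  · have h1 : IsOpen (((FiniteAdeleRing.unitEmbedding (𝓞 K) K).range ⊔ IdeleAction.congruenceUnits (K := K) 𝔪 :
        Subgroup (FiniteAdeleRing (𝓞 K) K)ˣ) : Set (FiniteAdeleRing (𝓞 K) K)ˣ) :=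
      Subgroup.isOpen_mono le_sup_right (IdeleAction.isOpen_congruenceUnits (K := K) 𝔪)
    exact h1.preimage (Continuous.units_map _ continuous_snd)
  · rintro _ ⟨k, rfl⟩
    rw [Subgroup.mem_comap]
    change IdeleAction.finitePart K (principalIdele K k) ∈ _
    rw [IdeleAction.finitePart_principalIdele K k]
    exact Subgroup.mem_sup_left ⟨k, rfl⟩

end Modulus

/-! ### §5. Local idèles in the congruence subgroup `I^𝔟_f` -/

section Congruence

variable {K : Type} [Field K] [NumberField K]

/-- A finite product of local idèles `∏_{w∈T} single w z_w` with `|z_w| = 1` and `|z_w − 1|_w ≤ |𝔟|_w`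
(`w ∈ T`) lies in the congruence subgroup `I^𝔟_f` (no condition off `T`: those components are `1`). [folklore] -/
theorem prod_single_mem_congruenceUnits {T : Finset (HeightOneSpectrum (𝓞 K))} (𝔟 : Ideal (𝓞 K))
    (z : (w : HeightOneSpectrum (𝓞 K)) → (w.adicCompletion K)ˣ)
    (hz1 : ∀ w ∈ T, Valued.v ((z w : w.adicCompletion K)) = 1)
    (hz : ∀ w ∈ T, Valued.v ((z w : w.adicCompletion K) - 1) ≤
      exp (-FractionalIdeal.count K w (𝔟 : FractionalIdeal (𝓞 K)⁰ K))) :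
    (∏ w ∈ T, IdeleAction.single w (z w)) ∈ IdeleAction.congruenceUnits (K := K) 𝔟 := by
  rw [IdeleAction.mem_congruenceUnits_iff]
  intro v
  by_cases hv : v ∈ T
  · rw [Automorphic.FiniteAdeleRing.unitOrd_eq_zero_iff, coe_prod_single_apply_of_mem z hv]
    exact ⟨hz1 v hv, hz v hv⟩
  · rw [Automorphic.FiniteAdeleRing.unitOrd_eq_zero_iff, coe_prod_single_apply_of_not_mem z hv, sub_self,
      Valuation.map_one, Valuation.map_zero]
    exact ⟨rfl, zero_le⟩

/-- A local idèle `single w u` with `|u| = 1` and `|u − 1|_w ≤ |𝔟|_w` lies in `I^𝔟_f`. [folklore] -/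
theorem single_mem_congruenceUnits (𝔟 : Ideal (𝓞 K)) (w : HeightOneSpectrum (𝓞 K)) (u : (w.adicCompletion K)ˣ)
    (hu1 : Valued.v (u : w.adicCompletion K) = 1)
    (hu : Valued.v ((u : w.adicCompletion K) - 1) ≤
      exp (-FractionalIdeal.count K w (𝔟 : FractionalIdeal (𝓞 K)⁰ K))) :
    IdeleAction.single w u ∈ IdeleAction.congruenceUnits (K := K) 𝔟 := by
  rw [IdeleAction.mem_congruenceUnits_iff]
  intro v
  by_cases hv : v = w
  · subst hv
    rw [Automorphic.FiniteAdeleRing.unitOrd_eq_zero_iff, IdeleAction.coe_single_apply_self]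
    exact ⟨hu1, hu⟩
  · rw [Automorphic.FiniteAdeleRing.unitOrd_eq_zero_iff, IdeleAction.coe_single_apply_of_ne w u hv, sub_self,
      Valuation.map_one, Valuation.map_zero]
    exact ⟨rfl, zero_le⟩

end Congruence

end Summit.BirchSwinnertonDyer.BirchSwinnertonDyer.Theorems.PrintCf2.FourTermCFT
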